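import Summits.BirchSwinnertonDyer.Rank1Residual.ManinAdditive.ShimuraCuspLifting
import Summits.BirchSwinnertonDyer.BirchSwinnertonDyer.Theorems.ManinLocalTwoThreeKatoCurveNoPlusDefectStub
import HarnessLib

/-!
# `2 ∤ c` on the no-rational-`2`-torsion / no-plus-defect cell of C2 (TURNKEY-an-15, Theorems side)

Summit `BirchSwinnertonDyer`, route `ManinLocalTwoThree` (cell bsd-f2-manin), crux C2 `ManinOddAtFour`
(stmt-BirchSwinnertonDyer-22967).  an g27's §5 theorem `not_two_dvd_maninConstant_of_noRationalTwoTorsion`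
(Sketch-an-g27.lean v3 sha16 497c462f3c7fcc1b, MEMO-an §69.2‴) VERBATIM, as handed over by the cell typer g14
(HOME/typer/ManinLocalTwoThreeNoRationalTwoTorsion.handover.lean 4880b7d23d2de2d3): it composes the landed leaf edge
`KatoCurve.twoAdicPolarWitness_of_noRationalTwoTorsion` (`…/ManinAdditive/ShimuraCuspLifting.lean`, §5 append p655990)
with the tree stub `Theorems.ManinLocalTwoThree.not_two_dvd_maninConstant_of_noPlusDefect_stub`
(`Theorems/ManinLocalTwoThreeKatoCurveNoPlusDefectStub.lean`), which lives INSIDE the theses cone — so the composition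
cannot sit in the `ManinAdditive` leaf (`lint.theses-cone`) and is landed here under `Theorems/` (prover-only).

RESULT: for a lattice-optimal `W` with `4 ∣ N`, NO cuspidal plus defect at `2` and NO rational `2`-torsion, the Manin
constant is odd — MODULO the named hypotheses: modularity `exists_isNewformOf`, Kato's fact
`kato_isIntegral_twistedSymbolSum_two_symbolClosure`, `KatoCurveExists`, E-es-66₂ `TwoAdicWitnessOfPlusIndexOdd` and
E-an-128₂ `ShimuraTwoForcesRationalTwoTorsion` (all taken as binders; nothing is discharged here).

HONEST FRAMING: a by-name composition; C2 `ManinOddAtFour`, Manin's conjecture and BSD are NOT proved by this.  No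
definitions, no named facts introduced, no sorry.
-/

set_option linter.dupNamespace false

noncomputable section

open scoped Classical MatrixGroups ModularForm

open CongruenceSubgroup Complex WeierstrassCurve Literature.NumberTheory.EllipticCurves
  Literature.NumberTheory.EllipticCurves.ModularForms
open Summit.BirchSwinnertonDyer.Rank1Residual.ManinAdditive.KatoCurve
  Summit.BirchSwinnertonDyer.Rank1Residual.ManinAdditive.CuspidalKummer

namespace Summit.BirchSwinnertonDyer.BirchSwinnertonDyer.Theorems.ManinLocalTwoThree

/-- PROVED turnkey on the C2 side (tree stub `not_two_dvd_maninConstant_of_noPlusDefect_stub`, law-free there):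
`2 ∤ c` for lattice-optimal `W`, `4 ∣ N`, no cuspidal plus defect at `2`, NO RATIONAL `2`-TORSION — modulo the named
Kato facts, `KatoCurveExists`, E-es-66₂ and E-an-128₂. (an g27 VERBATIM; TURNKEY-an-15.) -/
theorem not_two_dvd_maninConstant_of_noRationalTwoTorsion
    (hnf : exists_isNewformOf) (hF : kato_isIntegral_twistedSymbolSum_two_symbolClosure) (hK : KatoCurveExists)
    (h66 : TwoAdicWitnessOfPlusIndexOdd) (h : ShimuraTwoForcesRationalTwoTorsion)
    (W : WeierstrassCurve ℚ) [W.IsElliptic] [W.IsGloballyMinimal] {N : ℕ} [NeZero N]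
    (D : ModularParametrizationData W N) (hopt : ∀ z ∈ D.L.lattice, ∃ w ∈ periodLattice D.f, z = D.c * w)
    (h4 : 2 ^ 2 ∣ N) (hpd : CuspidalPlusDefectPrimeTo 2 D)
    (hT : ∀ e : ℚ, ¬ W.twoTorsionPolynomial.toPoly.IsRoot e) : ¬ (2 : ℤ) ∣ D.c :=
  not_two_dvd_maninConstant_of_noPlusDefect_stub
    hnf hF hK W D hopt h4 hpd (twoAdicPolarWitness_of_noRationalTwoTorsion h66 h W D hopt h4 hT)

end Summit.BirchSwinnertonDyer.BirchSwinnertonDyer.Theorems.ManinLocalTwoThree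

end
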